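import Mathlib.Analysis.SpecialFunctions.Sqrt
import Literature.NumberTheory.Transcendental.KZCalculusProofs

/-!
# Legendre's relation in modulus form: the divergence certificate (engine client L1)

Lines cusp-transport / hodge-locus of the crux `CompleteModGammaSector`
(stmt-KontsevichZagierPeriods-14233), first client of the certificate-transport engine E2'
(`stub_certificateTransport`): Legendre's relation in modulus form (GaussManinCertificates,
`LegendreModulusPropagation`, stmt-KontsevichZagierPeriods-3014), stubs
`stub_legendreCertificate` and `stub_legendreContinuousModulus`.

For `x, y, m ∈ (0, 1)` put `A = 1 − x²`, `B = 1 − m x²`, `C = 1 − y²`, `D = 1 − (1 − m) y²`,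
`κₓ = 1/(√A √B)`, `eₓ = √B/√A`, `κ_y = 1/(√C √D)`, `e_y = √D/√C`. The one-parameter family of
integrands is `F(m; x, y) = κₓ e_y + eₓ κ_y − κₓ κ_y` and the potentials are
`G₁ = ½ x A y² κₓ κ_y`, `G₂ = −½ x² y C κₓ κ_y`, with `g₁ = ∂ₓ G₁`, `g₂ = ∂_y G₂`:
`g₁ = ½ y² κₓ κ_y [(1 − 2x²) + m x² (1 − x²)/(1 − m x²)]`,
`g₂ = −½ x² κₓ κ_y [(1 − 2y²) + (1 − m) y² (1 − y²)/(1 − (1 − m) y²)]`.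

* `stub_legendreCertificate`: the CERTIFICATE `∂ₘ F = g₁ + g₂` pointwise on the open box, an
  exact identity. With `∂ₘ κₓ = x² κₓ/(2B)`, `∂ₘ eₓ = −x² κₓ/2`, `∂ₘ κ_y = −y² κ_y/(2D)`,
  `∂ₘ e_y = y² κ_y/2` and `e_y = D κ_y`, `eₓ = B κₓ`, one gets
  `∂ₘ F = κₓ κ_y [x² D/(2B) + y²/2 − x²/2 − B y²/(2D) − x²/(2B) + y²/(2D)]`, and
  `∂ₘ F − (g₁ + g₂) = ½ x² y² κₓ κ_y [−(1 − m)/B + m/D − m A/B + (1 − m) C/D]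
  = ½ x² y² κₓ κ_y [−B/B + D/D] = 0`.
  In Lean: rewrite `s ↦ F s (x, y)` into the closed form by `Real.sqrt_mul`, differentiate the
  four factors `κₓ, eₓ, κ_y, e_y` (`HasDerivAt.sqrt` and the quotient rule), replace
  `(√B)² = B`, `(√D)² = D`, `e_y = D κ_y`, `eₓ = B κₓ`, and close the resulting identity of
  rational functions in `x, y, m, √A, √B, √C, √D` by `field_simp; ring`.
* `stub_legendreContinuousModulus`: continuity of `m ↦ F(m; x, y)` on `[m₀, m₁] ⊂ (0, 1)` for
  interior `(x, y)` (it is differentiable there).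

## References

* M. Kontsevich, D. Zagier, *Periods*, in: Mathematics Unlimited — 2001 and Beyond, Springer
  (2001), §1.2 (Legendre's relation between periods, to be proved "by the rules").
-/

noncomputable section
set_option linter.dupNamespace false

namespace Summit.KontsevichZagierPeriods.KontsevichZagierPeriods.CompleteModGammaSectorEngine

open MeasureTheory Set
open Literature.NumberTheory.Transcendental
open Literature.NumberTheory.Transcendental.KZ

/-- `d/ds [1/(a √(1 − s p))] = p/(2 (√(1 − m p))²) · 1/(a √(1 − m p))` at `s = m`, provided
`a ≠ 0` and `1 − m p > 0`. [folklore] -/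
private theorem hasDerivAt_one_div_const_mul_sqrt {a p m : ℝ} (ha : a ≠ 0)
    (hB : 0 < 1 - m * p) :
    HasDerivAt (fun s : ℝ => 1 / (a * Real.sqrt (1 - s * p)))
      (p / (2 * Real.sqrt (1 - m * p) ^ 2) * (1 / (a * Real.sqrt (1 - m * p)))) m := by
  have hb : Real.sqrt (1 - m * p) ≠ 0 := Real.sqrt_ne_zero'.2 hB
  have h1 : HasDerivAt (fun s : ℝ => 1 - s * p) (-(1 * p)) m :=
    ((hasDerivAt_id' m).mul_const p).const_sub 1
  have h2 := (h1.sqrt hB.ne').const_mul a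
  refine ((hasDerivAt_const m (1 : ℝ)).fun_div h2 (mul_ne_zero ha hb)).congr_deriv ?_
  field_simp
  ring

/-- `d/ds [√(1 − s p)/a] = −(p/2) · 1/(a √(1 − m p))` at `s = m`, provided `1 − m p > 0`.
[folklore] -/
private theorem hasDerivAt_sqrt_div_const {a p m : ℝ} (hB : 0 < 1 - m * p) :
    HasDerivAt (fun s : ℝ => Real.sqrt (1 - s * p) / a)
      (-(p / 2) * (1 / (a * Real.sqrt (1 - m * p)))) m := by
  have h1 : HasDerivAt (fun s : ℝ => 1 - s * p) (-(1 * p)) m :=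
    ((hasDerivAt_id' m).mul_const p).const_sub 1
  refine ((h1.sqrt hB.ne').div_const a).congr_deriv ?_
  ring

/-- `d/ds [1/(c √(1 − (1 − s) q))] = −(q/(2 (√D)²)) · 1/(c √D)` at `s = m`, `D = 1 − (1 − m) q`,
provided `c ≠ 0` and `D > 0`. [folklore] -/
private theorem hasDerivAt_one_div_const_mul_sqrt' {c q m : ℝ} (hc : c ≠ 0)
    (hD : 0 < 1 - (1 - m) * q) :
    HasDerivAt (fun s : ℝ => 1 / (c * Real.sqrt (1 - (1 - s) * q)))
      (-(q / (2 * Real.sqrt (1 - (1 - m) * q) ^ 2)) *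
        (1 / (c * Real.sqrt (1 - (1 - m) * q)))) m := by
  have hd : Real.sqrt (1 - (1 - m) * q) ≠ 0 := Real.sqrt_ne_zero'.2 hD
  have h1 : HasDerivAt (fun s : ℝ => 1 - (1 - s) * q) (-(-1 * q)) m :=
    (((hasDerivAt_id' m).const_sub 1).mul_const q).const_sub 1
  have h2 := (h1.sqrt hD.ne').const_mul c
  refine ((hasDerivAt_const m (1 : ℝ)).fun_div h2 (mul_ne_zero hc hd)).congr_deriv ?_
  field_simp
  ring

/-- `d/ds [√(1 − (1 − s) q)/c] = (q/2) · 1/(c √D)` at `s = m`, `D = 1 − (1 − m) q`, provided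
`D > 0`. [folklore] -/
private theorem hasDerivAt_sqrt_div_const' {c q m : ℝ} (hD : 0 < 1 - (1 - m) * q) :
    HasDerivAt (fun s : ℝ => Real.sqrt (1 - (1 - s) * q) / c)
      (q / 2 * (1 / (c * Real.sqrt (1 - (1 - m) * q)))) m := by
  have h1 : HasDerivAt (fun s : ℝ => 1 - (1 - s) * q) (-(-1 * q)) m :=
    (((hasDerivAt_id' m).const_sub 1).mul_const q).const_sub 1
  refine ((h1.sqrt hD.ne').div_const c).congr_deriv ?_
  ring

/-- For a nonnegative real `D` with `√D ≠ 0`: `√D/√C = D · 1/(√C √D)` (`e_y = D κ_y`). [folklore] -/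
private theorem sqrt_div_sqrt_eq_mul_one_div {C D : ℝ} (hD : 0 ≤ D) (hd : Real.sqrt D ≠ 0) :
    Real.sqrt D / Real.sqrt C = D * (1 / (Real.sqrt C * Real.sqrt D)) := by
  calc Real.sqrt D / Real.sqrt C
      = Real.sqrt D * Real.sqrt D / (Real.sqrt C * Real.sqrt D) := (mul_div_mul_right _ _ hd).symm
    _ = D * (1 / (Real.sqrt C * Real.sqrt D)) := by rw [Real.mul_self_sqrt hD, mul_one_div]

/-- **The Legendre certificate** (engine client L1). On the open box `(x, y, m) ∈ (0,1)³` the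
modulus-derivative of Legendre's combination
`F(m; x, y) = κₘ(x) e_{1−m}(y) + eₘ(x) κ_{1−m}(y) − κₘ(x) κ_{1−m}(y)` is the divergence
`g₁ + g₂ = ∂ₓ G₁ + ∂_y G₂` of the potentials `G₁ = ½ x (1 − x²) y² κκ`, `G₂ = −½ x² y (1 − y²) κκ`
(an exact identity of algebraic functions; see the module docstring for the computation).
[cite: KontsevichZagier2001, §1.2] -/
theorem stub_legendreCertificate :
    ∀ (F : ℝ → (Fin 2 → ℝ) → ℝ), (∀ (m : ℝ) (x : Fin 2 → ℝ), F m x = 1 / Real.sqrt ((1 - x 0 ^ 2)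
      * (1 - m * x 0 ^ 2)) * (Real.sqrt (1 - (1 - m) * x 1 ^ 2) / Real.sqrt (1 - x 1 ^ 2)) +
      Real.sqrt (1 - m * x 0 ^ 2) / Real.sqrt (1 - x 0 ^ 2) * (1 / Real.sqrt ((1 - x 1 ^ 2) *
      (1 - (1 - m) * x 1 ^ 2))) - 1 / Real.sqrt ((1 - x 0 ^ 2) * (1 - m * x 0 ^ 2)) *
      (1 / Real.sqrt ((1 - x 1 ^ 2) * (1 - (1 - m) * x 1 ^ 2)))) → ∀ (x : Fin 2 → ℝ) (m : ℝ),
      x 0 ∈ Set.Ioo (0:ℝ) 1 → x 1 ∈ Set.Ioo (0:ℝ) 1 → m ∈ Set.Ioo (0:ℝ) 1 →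
      HasDerivAt (fun s : ℝ => F s x) ((1 / 2 * x 1 ^ 2 * (1 / (Real.sqrt (1 - x 0 ^ 2) *
      Real.sqrt (1 - m * x 0 ^ 2))) * (1 / (Real.sqrt (1 - x 1 ^ 2) *
      Real.sqrt (1 - (1 - m) * x 1 ^ 2))) * ((1 - 2 * x 0 ^ 2) + m * x 0 ^ 2 * (1 - x 0 ^ 2) /
      (1 - m * x 0 ^ 2))) + (-(1 / 2 * x 0 ^ 2 * (1 / (Real.sqrt (1 - x 0 ^ 2) *
      Real.sqrt (1 - m * x 0 ^ 2))) * (1 / (Real.sqrt (1 - x 1 ^ 2) *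
      Real.sqrt (1 - (1 - m) * x 1 ^ 2))) * ((1 - 2 * x 1 ^ 2) + (1 - m) * x 1 ^ 2 *
      (1 - x 1 ^ 2) / (1 - (1 - m) * x 1 ^ 2))))) m := by
  intro F hF x m hx0 hx1 hm
  obtain ⟨hx0₀, hx0₁⟩ := hx0
  obtain ⟨hx1₀, hx1₁⟩ := hx1
  obtain ⟨hm₀, hm₁⟩ := hm
  have hx0sq : x 0 ^ 2 < 1 := by nlinarith [mul_pos hx0₀ (sub_pos.2 hx0₁)]
  have hx1sq : x 1 ^ 2 < 1 := by nlinarith [mul_pos hx1₀ (sub_pos.2 hx1₁)]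
  have hA : 0 < 1 - x 0 ^ 2 := by linarith
  have hC : 0 < 1 - x 1 ^ 2 := by linarith
  have hB : 0 < 1 - m * x 0 ^ 2 := by
    have h := mul_lt_mul_of_pos_right hm₁ (pow_pos hx0₀ 2)
    linarith
  have hD : 0 < 1 - (1 - m) * x 1 ^ 2 := by
    have h := mul_lt_mul_of_pos_right (sub_lt_self 1 hm₀) (pow_pos hx1₀ 2)
    linarith
  -- (`field_simp` normalises `m * x 0 ^ 2` to `x 0 ^ 2 * m`; it needs the facts in that form)
  have hB' : 1 - x 0 ^ 2 * m ≠ 0 := by rw [mul_comm]; exact hB.ne'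
  have hD' : 1 - (1 - m) * x 1 ^ 2 ≠ 0 := hD.ne'
  have ha : Real.sqrt (1 - x 0 ^ 2) ≠ 0 := Real.sqrt_ne_zero'.2 hA
  have hb : Real.sqrt (1 - m * x 0 ^ 2) ≠ 0 := Real.sqrt_ne_zero'.2 hB
  have hb' : Real.sqrt (1 - x 0 ^ 2 * m) ≠ 0 := by rw [mul_comm]; exact hb
  have hc : Real.sqrt (1 - x 1 ^ 2) ≠ 0 := Real.sqrt_ne_zero'.2 hC
  have hd : Real.sqrt (1 - (1 - m) * x 1 ^ 2) ≠ 0 := Real.sqrt_ne_zero'.2 hD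
  -- the closed form of `s ↦ F s x` (valid for every real `s`, as `1 - x 0 ^ 2, 1 - x 1 ^ 2 ≥ 0`)
  have hfun : (fun s : ℝ => F s x) = fun s : ℝ =>
      1 / (Real.sqrt (1 - x 0 ^ 2) * Real.sqrt (1 - s * x 0 ^ 2)) *
            (Real.sqrt (1 - (1 - s) * x 1 ^ 2) / Real.sqrt (1 - x 1 ^ 2)) +
          Real.sqrt (1 - s * x 0 ^ 2) / Real.sqrt (1 - x 0 ^ 2) *
            (1 / (Real.sqrt (1 - x 1 ^ 2) * Real.sqrt (1 - (1 - s) * x 1 ^ 2))) -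
        1 / (Real.sqrt (1 - x 0 ^ 2) * Real.sqrt (1 - s * x 0 ^ 2)) *
          (1 / (Real.sqrt (1 - x 1 ^ 2) * Real.sqrt (1 - (1 - s) * x 1 ^ 2))) := by
    funext s
    rw [hF, Real.sqrt_mul hA.le, Real.sqrt_mul hC.le]
  rw [hfun]
  have h1 := hasDerivAt_one_div_const_mul_sqrt (p := x 0 ^ 2) (m := m) ha hB
  have h2 := hasDerivAt_sqrt_div_const (a := Real.sqrt (1 - x 0 ^ 2)) (p := x 0 ^ 2) (m := m) hB
  have h3 := hasDerivAt_one_div_const_mul_sqrt' (q := x 1 ^ 2) (m := m) hc hD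
  have h4 := hasDerivAt_sqrt_div_const' (c := Real.sqrt (1 - x 1 ^ 2)) (q := x 1 ^ 2) (m := m) hD
  refine (((h1.fun_mul h4).fun_add (h2.fun_mul h3)).fun_sub (h1.fun_mul h3)).congr_deriv ?_
  rw [Real.sq_sqrt hB.le, Real.sq_sqrt hD.le, sqrt_div_sqrt_eq_mul_one_div hD.le hd,
    sqrt_div_sqrt_eq_mul_one_div hB.le hb]
  field_simp
  ring

/-- Continuity of the Legendre family in the modulus on `[m₀, m₁] ⊂ (0, 1)` for interior `(x, y)`:
a corollary of `stub_legendreCertificate` (the family is differentiable in `m` on `(0, 1)`).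
[cite: KontsevichZagier2001, §1.2] -/
theorem stub_legendreContinuousModulus :
    ∀ (F : ℝ → (Fin 2 → ℝ) → ℝ), (∀ (m : ℝ) (x : Fin 2 → ℝ), F m x = 1 / Real.sqrt ((1 - x 0 ^ 2)
      * (1 - m * x 0 ^ 2)) * (Real.sqrt (1 - (1 - m) * x 1 ^ 2) / Real.sqrt (1 - x 1 ^ 2)) +
      Real.sqrt (1 - m * x 0 ^ 2) / Real.sqrt (1 - x 0 ^ 2) * (1 / Real.sqrt ((1 - x 1 ^ 2) *
      (1 - (1 - m) * x 1 ^ 2))) - 1 / Real.sqrt ((1 - x 0 ^ 2) * (1 - m * x 0 ^ 2)) *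
      (1 / Real.sqrt ((1 - x 1 ^ 2) * (1 - (1 - m) * x 1 ^ 2)))) → ∀ (x : Fin 2 → ℝ) (m₀ m₁ : ℝ),
      x 0 ∈ Set.Ioo (0:ℝ) 1 → x 1 ∈ Set.Ioo (0:ℝ) 1 → 0 < m₀ → m₁ < 1 →
      ContinuousOn (fun s : ℝ => F s x) (Set.Icc m₀ m₁) := by
  intro F hF x m₀ m₁ hx0 hx1 hm₀ hm₁ s hs
  exact (stub_legendreCertificate F hF x s hx0 hx1
    ⟨hm₀.trans_le hs.1, hs.2.trans_lt hm₁⟩).continuousAt.continuousWithinAt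

end Summit.KontsevichZagierPeriods.KontsevichZagierPeriods.CompleteModGammaSectorEngine
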